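import Literature.AnabelianGeometry.SemiGraphs.PSCEdgeLikeCharacterizationReduction
import Literature.AnabelianGeometry.SemiGraphs.PSCTwoComponentShape
import Literature.AnabelianGeometry.SemiGraphs.PSCTwoComponentUnmarkedEdges
import Literature.AnabelianGeometry.SemiGraphs.ProSigmaCompletionTFG
import HarnessLib

/-!
# [IUTchI] Rmk. 1.2.3 (v) HOLDS at genuine NONCUSPIDAL two-component data (two smooth components, one node)

Mochizuki, *Inter-universal Teichmüller theory I* [IUTchI] Rmk. 1.2.3 (v), kurims manuscript p. 43 (the
replacement text of [CombGC] Rmk. 1.4.4): for `G` of pro-`Σ` PSC-type, `Σ = {l}`, NONCUSPIDAL, "the nodal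
edge-like subgroups of `Π_G` may be characterized as the maximal closed subgroups `A ⊆ Π_G` isomorphic to
`ℤ_l` which satisfy the following condition: for every characteristic open subgroup `Π_{G'} ⊆ Π_G` … the
cyclic finite étale covering `G' → G''` is nodally totally ramified.  Here, we note further that … [it] is
nodally totally ramified if and only if it is module-wise nodal" [cite: Mochizuki2012, IUTchI Rmk 1.2.3(v) p.43]
— typed by abc-iut-L3-t4 as `PSCDatum.NodalEdgeLikeCharacterization`, abc-iut FACT-LIST row F-1937 in the
origin form `NodalEdgeLikeCharacterizationHolds Ω` (universal closure refuted at junk data, p430625; in the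
tree so far only the VACUOUS no-node instances `nodalEdgeLikeCharacterization_of_isEmpty`,
`nodalEdgeLikeCharacterizationHolds_of_smoothProper`).  PROOF-ONLY file (abc-iut-w5-d160, D-0079 L-F row
F-1937; no definitions).

## The genuine instance

abc-iut-f-165's `PSCTwoComponentShape.lean` constructs, for every nonempty set of primes `Σ` and all
`g₁, g₂ ≥ 1`, the PSC datum of the pointed stable curve with two smooth components of genera `g₁`, `g₂`
meeting at ONE node and NO marked points: `Π` a pro-`Σ` completion `ι : Γ_{g₁+g₂,0} → Π` of the surface
group of the smoothing, `Π_{v₀} = cl ι⟨a_i, b_i : i < g₁⟩`, `Π_{v₁} = cl ι⟨a_i, b_i : i ≥ g₁⟩`, node group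
`Π_e = cl ι⟨z⟩` for the vanishing cycle `z = ∏_{i<g₁} [a_i, b_i]` (`exists_twoComponentOrigin_holds`, with
[CombGC] Prop. 1.2 (i) = row F-0459 there).  These data are NONCUSPIDAL, so row F-1937 is NOT vacuous at
them, and by `nodalEdgeLikeCharacterization_of_containment` (companion
`PSCEdgeLikeCharacterizationReduction.lean`: F-1937 ⇐ profinite topologically finitely generated `Π` +
node groups procyclic and infinite + "containment between conjugates of node groups determines the node",
the last being trivial with one node) the only input still owed is:

* `infinite_topologicalClosure_nodeLoop` — **the node group `cl ι⟨∏_{i<g₁}[a_i,b_i]⟩` is INFINITE.**  The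
  loop `z` dies in every abelian quotient, so we use abc-iut-f-164's Heisenberg `ℓ`-groups
  (`ProSigmaHeisenbergSeparation.lean`, `PSCTwoComponentUnmarkedEdges.lean`): f-164's homomorphism
  `Γ_{g₁+g₂,0} → (ℤ/ℓⁿ × ℤ/ℓⁿ) ⋊ ℤ/ℓⁿ`, `a_0 ↦ X, b_0 ↦ Y, a_{g₁} ↦ Y, b_{g₁} ↦ X`, all other handles `↦ 1`
  (`exists_hom_two_handles`, consumed by name; the relator `∏_i [a_i,b_i]` goes to `[X,Y]·[Y,X] = 1`)
  sends `z` to the central generator `Z = [X,Y]` of order `ℓⁿ` (`hom_two_handles_vanishingCycle`);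
  extending continuously to `Π` (`exists_continuous_extend_of_card_primePow`) shows that `ι(z)` has order
  divisible by `ℓⁿ` for every `n`, i.e. infinite order.

Results: `nodalEdgeLikeCharacterization_of_twoComponentClosed` (row F-1937's datum-level statement at every
datum of this shape — hypothesis-free apart from the shape binders) and
`exists_twoComponentClosedOrigin_rmk123v_holds`: an origin INHABITED, for every nonempty `Σ` (in particular
`Σ = {l}`) and all `g₁, g₂ ≥ 1` (STURDY data when `g₁, g₂ ≥ 2`), by these genuine noncuspidal nodal data
(`i = 2`, `n = 1`, `r = 0`), at which **F-1937 (`NodalEdgeLikeCharacterizationHolds`) and F-0459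
(`OpenInterDeterminesComponentHolds`) both HOLD** — the first kernel instance of [IUTchI] Rmk. 1.2.3 (v) at
data WITH a node.  Honest scope: an instance at data of the shape of genuine two-component curves
(consistency evidence for the typed row), not the printed theorem for all pointed stable curves; the
identification of the PSC-fundamental group of the stable curve with the pro-`Σ` completion of the surface
group (specialisation) is a hypothesis on the shape, not constructed.  Nothing here takes a side on
[IUTchIII] Cor. 3.12. [cite: MochizukiCombGC2007, Prop 1.2(i) p.8] [cite: MochizukiSemiAnbd2006, Ex. 2.10 p.31]
-/

noncomputable section

open Multiplicative

/-! ### abc-iut-f-164's two-handle homomorphisms on the vanishing cycle of the closed two-component shape -/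

namespace Literature.GroupTheory.CombinatorialGroupTheory.PuncturedSurfaceGroup

variable {g r : ℕ}

/-- In a list without duplicates, a product whose factors are `1` except at one entry equals that
factor. [folklore] -/
private theorem prod_map_finRange_single' {M : Type*} [Monoid M] {n : ℕ} (i₀ : Fin n) (F : Fin n → M)
    (hF : ∀ i, i ≠ i₀ → F i = 1) : ((List.finRange n).map F).prod = F i₀ := by
  rw [List.prod_map_eq_pow_single i₀ F (fun i hi _ => hF i hi),
    List.count_eq_one_of_mem (List.nodup_finRange n) (List.mem_finRange i₀), pow_one]

/-- **abc-iut-f-164's two-handle homomorphism (`exists_hom_two_handles`: `a_{i₀} ↦ X, b_{i₀} ↦ Y`,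
`a_{i₁} ↦ Y, b_{i₁} ↦ X`, every other generator `↦ 1`) on the vanishing cycle** `z = ∏_{i<g₁} [a_i, b_i]`
of the two-component CLOSED shape (abc-iut-f-165's `List.ofFn`/`Fin.castAdd` presentation; active handles
`a_0, b_0` on the first component and `a_{g₁}, b_{g₁}` on the second): `ψ(z) = [X, Y]`.
[cite: MochizukiCombGC2007, Prop 1.2(i) p.8] -/
theorem hom_two_handles_vanishingCycle {Q : Type*} [Group Q] {g₁ g₂ : ℕ} (h₁ : 0 < g₁) (h₂ : 0 < g₂)
    {X Y : Q} (ψ : PuncturedSurfaceGroup (g₁ + g₂) r →* Q)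
    (ha : ψ (a (Fin.castAdd g₂ ⟨0, h₁⟩)) = X) (hb : ψ (b (Fin.castAdd g₂ ⟨0, h₁⟩)) = Y)
    (hab : ∀ i, i ≠ Fin.castAdd g₂ ⟨0, h₁⟩ → i ≠ Fin.natAdd g₁ ⟨0, h₂⟩ → ψ (a i) = 1 ∧ ψ (b i) = 1) :
    ψ ((List.ofFn fun i : Fin g₁ =>
        a (g := g₁ + g₂) (r := r) (Fin.castAdd g₂ i) * b (Fin.castAdd g₂ i) *
          (a (Fin.castAdd g₂ i))⁻¹ * (b (Fin.castAdd g₂ i))⁻¹).prod) = X * Y * X⁻¹ * Y⁻¹ := by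
  rw [map_list_prod, List.map_ofFn, List.ofFn_eq_map]
  have hsingle : ∀ i : Fin g₁, i ≠ ⟨0, h₁⟩ →
      (⇑ψ ∘ fun i : Fin g₁ => a (g := g₁ + g₂) (r := r) (Fin.castAdd g₂ i) * b (Fin.castAdd g₂ i) *
        (a (Fin.castAdd g₂ i))⁻¹ * (b (Fin.castAdd g₂ i))⁻¹) i = 1 := by
    intro i hi
    have hne₀ : Fin.castAdd g₂ i ≠ Fin.castAdd g₂ ⟨0, h₁⟩ := fun h => hi (Fin.castAdd_inj.mp h)
    have hne₁ : Fin.castAdd g₂ i ≠ Fin.natAdd g₁ ⟨0, h₂⟩ := by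
      intro h
      have := congrArg Fin.val h
      simp only [Fin.val_castAdd, Fin.val_natAdd] at this
      omega
    obtain ⟨h1, h2⟩ := hab _ hne₀ hne₁
    simp only [Function.comp_apply, map_mul, map_inv, h1, h2, inv_one, mul_one]
  rw [prod_map_finRange_single' ⟨0, h₁⟩ _ hsingle]
  simp only [Function.comp_apply, map_mul, map_inv, ha, hb]

end Literature.GroupTheory.CombinatorialGroupTheory.PuncturedSurfaceGroup

/-! ### The node group of the two-component closed shape is infinite -/

namespace Literature.AnabelianGeometry.SemiGraphs

open scoped Pointwise
open Literature.GroupTheory.CombinatorialGroupTheory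
open Literature.AnabelianGeometry.AbsoluteAnabelian (IsTopologicallyFinitelyGenerated)
open SemiGraphOfAnabelioids (IsProSigmaCompletion)

namespace PSCDatum

universe u

section NodeLoop

variable {P : Type u} [Group P] [TopologicalSpace P] [IsTopologicalGroup P] [CompactSpace P]
  [TotallyDisconnectedSpace P] {Sigma : Set ℕ} {g₁ g₂ : ℕ}

/-- **The vanishing cycle has infinite order in the pro-`Σ` completion**: for `ι : Γ_{g₁+g₂,0} → Π` a
pro-`Σ` completion (`g₁, g₂ ≥ 1`, `ℓ ∈ Σ`), the closed procyclic subgroup `cl ι⟨∏_{i<g₁}[a_i,b_i]⟩` — the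
node group of the two-component closed shape — is INFINITE: for every `n` the Heisenberg quotient
`Γ → (ℤ/ℓⁿ × ℤ/ℓⁿ) ⋊ ℤ/ℓⁿ` with two crosswise active handles extends continuously to `Π` and sends the
cycle to an element of order `ℓⁿ`. [cite: MochizukiSemiAnbd2006, Ex. 2.10 p.31] -/
theorem infinite_topologicalClosure_nodeLoop (h₁ : 0 < g₁) (h₂ : 0 < g₂)
    {ι : PuncturedSurfaceGroup (g₁ + g₂) 0 →* P} (hι : IsProSigmaCompletion Sigma ι) {ℓ : ℕ}
    (hℓ : ℓ.Prime) (hℓS : ℓ ∈ Sigma) :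
    ((((Subgroup.zpowers (List.ofFn fun i : Fin g₁ =>
        PuncturedSurfaceGroup.a (g := g₁ + g₂) (r := 0) (Fin.castAdd g₂ i) *
          PuncturedSurfaceGroup.b (Fin.castAdd g₂ i) *
            (PuncturedSurfaceGroup.a (Fin.castAdd g₂ i))⁻¹ *
              (PuncturedSurfaceGroup.b (Fin.castAdd g₂ i))⁻¹).prod).map ι).topologicalClosure :
      Subgroup P) : Set P).Infinite := by
  set z : PuncturedSurfaceGroup (g₁ + g₂) 0 := (List.ofFn fun i : Fin g₁ =>
      PuncturedSurfaceGroup.a (g := g₁ + g₂) (r := 0) (Fin.castAdd g₂ i) *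
        PuncturedSurfaceGroup.b (Fin.castAdd g₂ i) * (PuncturedSurfaceGroup.a (Fin.castAdd g₂ i))⁻¹ *
          (PuncturedSurfaceGroup.b (Fin.castAdd g₂ i))⁻¹).prod with hz
  have hne : (Fin.castAdd g₂ ⟨0, h₁⟩ : Fin (g₁ + g₂)) ≠ Fin.natAdd g₁ ⟨0, h₂⟩ := by
    intro h
    have := congrArg Fin.val h
    simp only [Fin.val_castAdd, Fin.val_natAdd] at this
    omega
  -- `ι z` has infinite order
  have key : ¬ IsOfFinOrder (ι z) := by
    intro hfin
    obtain ⟨d, hd⟩ : ∃ d : ℕ, orderOf (ι z) = d := ⟨_, rfl⟩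
    have hdpos : 0 < d := hd ▸ hfin.orderOf_pos
    have hzd : ι z ^ d = 1 := by rw [← hd]; exact pow_orderOf_eq_one (ι z)
    obtain ⟨φ, X, Y, Z, hXY, hZc, hZ, hcard⟩ := Heisenberg.exists_heisenbergTriple_central (ℓ ^ d)
    letI : TopologicalSpace
        (Multiplicative (ZMod (ℓ ^ d) × ZMod (ℓ ^ d)) ⋊[φ] Multiplicative (ZMod (ℓ ^ d))) := ⊥
    haveI : DiscreteTopology
        (Multiplicative (ZMod (ℓ ^ d) × ZMod (ℓ ^ d)) ⋊[φ] Multiplicative (ZMod (ℓ ^ d))) := ⟨rfl⟩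
    haveI : Finite (Multiplicative (ZMod (ℓ ^ d) × ZMod (ℓ ^ d)) ⋊[φ] Multiplicative (ZMod (ℓ ^ d))) :=
      Nat.finite_of_card_ne_zero (by rw [hcard]; exact pow_ne_zero _ (pow_ne_zero _ hℓ.ne_zero))
    obtain ⟨ψ, ha0, hb0, -, -, hab, -⟩ :=
      PuncturedSurfaceGroup.exists_hom_two_handles (r := 0) (Fin.castAdd g₂ ⟨0, h₁⟩)
        (Fin.natAdd g₁ ⟨0, h₂⟩) hne X Y (by rw [hXY]; exact hZc)
    have hψz : ψ z = Z := by
      rw [hz, PuncturedSurfaceGroup.hom_two_handles_vanishingCycle h₁ h₂ ψ ha0 hb0 hab, hXY]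
    obtain ⟨Ψ, -, hΨ⟩ := hι.exists_continuous_extend_of_card_primePow hℓ hℓS (k := d * 3)
      (by rw [hcard, pow_mul]) ψ
    have h1 : Z ^ d = 1 := by
      rw [← hψz, ← hΨ, ← map_pow, hzd, map_one]
    have hdvd : ℓ ^ d ∣ d := (hZ d).mp h1
    exact absurd (Nat.le_of_dvd hdpos hdvd) (not_le.mpr (Nat.lt_pow_self hℓ.one_lt))
  rw [MonoidHom.map_zpowers]
  exact (infinite_zpowers.mpr key).mono (Subgroup.le_topologicalClosure _)

end NodeLoop

/-! ### Row F-1937 at the two-component closed shape -/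

section Shape

variable {P : Type u} [Group P] [TopologicalSpace P] [IsTopologicalGroup P] [CompactSpace P]
  [TotallyDisconnectedSpace P] {g₁ g₂ : ℕ}

/-- **[IUTchI] Rmk. 1.2.3 (v) as typed (`NodalEdgeLikeCharacterization`, row F-1937's datum-level
statement) HOLDS at every datum of two-component closed shape**: `Π` profinite, a pro-`Σ` completion
`ι : Γ_{g₁+g₂,0} → Π` (`g₁, g₂ ≥ 1`), all nodes equal to one node `e₀` with `Π_{e₀} = cl ι⟨∏_{i<g₁}[a_i,b_i]⟩`
(whatever the vertices and their groups).  By `nodalEdgeLikeCharacterization_of_containment`: `Π` is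
topologically finitely generated, the node group is procyclic and — `infinite_topologicalClosure_nodeLoop` —
infinite, and containment trivially determines the (unique) node.
[cite: Mochizuki2012, IUTchI Rmk 1.2.3(v) p.43] -/
theorem nodalEdgeLikeCharacterization_of_twoComponentClosed (G : PSCDatum P) {Sigma : Set ℕ}
    (hne : Sigma.Nonempty) (hprime : ∀ p ∈ Sigma, p.Prime) (h₁ : 0 < g₁) (h₂ : 0 < g₂)
    (ι : PuncturedSurfaceGroup (g₁ + g₂) 0 →* P) (hι : IsProSigmaCompletion Sigma ι)
    (e₀ : G.graph.N) (hE : ∀ e, e = e₀)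
    (hN : G.nodeGp e₀ = ((Subgroup.zpowers (List.ofFn fun i : Fin g₁ =>
      PuncturedSurfaceGroup.a (g := g₁ + g₂) (r := 0) (Fin.castAdd g₂ i) *
        PuncturedSurfaceGroup.b (Fin.castAdd g₂ i) * (PuncturedSurfaceGroup.a (Fin.castAdd g₂ i))⁻¹ *
          (PuncturedSurfaceGroup.b (Fin.castAdd g₂ i))⁻¹).prod).map ι).topologicalClosure) :
    G.NodalEdgeLikeCharacterization := by
  obtain ⟨ℓ, hℓS⟩ := hne
  have hℓ : ℓ.Prime := hprime ℓ hℓS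
  refine G.nodalEdgeLikeCharacterization_of_containment
    (IsProSigmaCompletion.isTopologicallyFinitelyGenerated_of_puncturedSurfaceGroup (MulEquiv.refl _) hι)
    (fun e => ?_) (fun e => ?_) (fun e e' _ _ _ => by rw [hE e, hE e'])
  · rw [hE e, hN, MonoidHom.map_zpowers]
    exact ⟨_, rfl⟩
  · rw [hE e, hN]
    exact infinite_topologicalClosure_nodeLoop h₁ h₂ hι hℓ hℓS

omit [IsTopologicalGroup P] [CompactSpace P] [TotallyDisconnectedSpace P] in
/-- **Non-vacuity of the characterized class**: at such a datum the node group itself is nodal (so the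
`iff` of Rmk. 1.2.3 (v) is about an inhabited predicate), and the datum is noncuspidal as soon as it has
no cusps, so that the guard of row F-1937 is met. [cite: Mochizuki2012, IUTchI Rmk 1.2.3(v) p.43] -/
theorem isNodal_nodeGp_and_isNoncuspidal (G : PSCDatum P) (e₀ : G.graph.N) [IsEmpty G.graph.C] :
    G.IsNodal (G.nodeGp e₀) ∧ G.graph.IsNoncuspidal :=
  ⟨⟨e₀, 1, (one_smul _ _).symm⟩, Fintype.card_eq_zero⟩

end Shape

/-! ### The origin of two-component closed data: rows F-1937 and F-0459 hold, inhabited by genuine data -/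

/-- **An origin at which [IUTchI] Rmk. 1.2.3 (v) (row F-1937, `NodalEdgeLikeCharacterizationHolds`) and
[CombGC] Prop. 1.2 (i) (row F-0459, `OpenInterDeterminesComponentHolds`) HOLD, INHABITED by the genuine
NONCUSPIDAL NODAL data of abc-iut-f-165** — two smooth components of genera `g₁, g₂ ≥ 1` meeting at one
node, no marked points (`i = 2`, `n = 1`, `r = 0`), over a pro-`Σ` completion of `Γ_{g₁+g₂,0}`, for EVERY
nonempty set of primes `Σ` (take `Σ = {l}` for the non-vacuous reading of F-1937) and STURDY when
`g₁, g₂ ≥ 2`.  The origin is abc-iut-f-165's origin of two-component closed data (where F-0459 is its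
`exists_twoComponentOrigin_holds`) cut down to profinite carriers with the displayed node group; F-1937
there is `nodalEdgeLikeCharacterization_of_twoComponentClosed`.  First kernel instance of row F-1937 at data
WITH a node. [cite: Mochizuki2012, IUTchI Rmk 1.2.3(v) p.43] [cite: MochizukiCombGC2007, Prop 1.2(i) p.8] -/
theorem exists_twoComponentClosedOrigin_rmk123v_holds :
    ∃ Ω : PSCOrigin.{0},
      (∀ (S : Set ℕ), S.Nonempty → (∀ p ∈ S, p.Prime) → ∀ g₁ g₂ : ℕ, 0 < g₁ → 0 < g₂ →
        ∃ (Q : ProfiniteGrp.{0}) (ι : PuncturedSurfaceGroup (g₁ + g₂) 0 →* Q) (G : PSCDatum Q),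
          IsProSigmaCompletion S ι ∧ Ω.IsOfPSCType G ∧ G.Sigma = S ∧ G.graph.IsNoncuspidal ∧
          G.graph.i = 2 ∧ G.graph.n = 1 ∧ G.graph.r = 0 ∧ (∃ e₀ : G.graph.N, G.IsNodal (G.nodeGp e₀)) ∧
          (2 ≤ g₁ → 2 ≤ g₂ → G.IsSturdy)) ∧
      NodalEdgeLikeCharacterizationHolds Ω ∧ OpenInterDeterminesComponentHolds Ω := by
  classical
  obtain ⟨Ω₀, hinh, h0459⟩ := exists_twoComponentOrigin_holds
  -- the origin: f-165's two-component closed data, with profinite carrier and the displayed node group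
  let Ω : PSCOrigin.{0} :=
    ⟨fun {Q} _ _ G => Ω₀.IsOfPSCType G ∧ ∃ (_ : IsTopologicalGroup Q), CompactSpace Q ∧
      TotallyDisconnectedSpace Q ∧
      ∃ (g₁ g₂ : ℕ) (ι : PuncturedSurfaceGroup (g₁ + g₂) 0 →* Q) (e₀ : G.graph.N),
        0 < g₁ ∧ 0 < g₂ ∧ IsProSigmaCompletion G.Sigma ι ∧ (∀ e, e = e₀) ∧
        G.nodeGp e₀ = ((Subgroup.zpowers (List.ofFn fun i : Fin g₁ =>
          PuncturedSurfaceGroup.a (g := g₁ + g₂) (r := 0) (Fin.castAdd g₂ i) *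
            PuncturedSurfaceGroup.b (Fin.castAdd g₂ i) * (PuncturedSurfaceGroup.a (Fin.castAdd g₂ i))⁻¹ *
              (PuncturedSurfaceGroup.b (Fin.castAdd g₂ i))⁻¹).prod).map ι).topologicalClosure⟩
  refine ⟨Ω, fun S hne hprime g₁ g₂ h₁ h₂ => ?_, fun Q _ _ _ G hG => ?_, fun Q _ _ _ G hG => ?_⟩
  · -- (1) inhabited by f-165's genuine datum
    obtain ⟨Q, ι, G, hι, hG₀, hS, hi, hn, hr, ⟨v₀, v₁, -, -, -, -, -, hnode⟩, hst⟩ :=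
      hinh S hne hprime g₁ g₂ h₁ h₂
    have hn1 : Fintype.card G.graph.N = 1 := hn
    obtain ⟨e₀, he₀⟩ := Fintype.card_eq_one_iff.mp hn1
    haveI : IsEmpty G.graph.C := Fintype.card_eq_zero_iff.mp hr
    refine ⟨Q, ι, G, hι, ⟨hG₀, inferInstance, inferInstance, inferInstance, g₁, g₂, ι, e₀, h₁, h₂,
      hS ▸ hι, he₀, (hnode e₀).2⟩, hS, Fintype.card_eq_zero, hi, hn, hr,
      ⟨e₀, (G.isNodal_nodeGp_and_isNoncuspidal e₀).1⟩, hst⟩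
  · -- (2) F-1937 at `Ω`
    obtain ⟨-, _, hc, hd, g₁, g₂, ι, e₀, h₁, h₂, hι, hE, hN⟩ := hG
    haveI := hc
    haveI := hd
    exact G.nodalEdgeLikeCharacterization_of_twoComponentClosed G.sigma_nonempty G.sigma_prime h₁ h₂ ι
      hι e₀ hE hN
  · -- (3) F-0459 at `Ω` (abc-iut-f-165)
    exact h0459 G hG.1

end PSCDatum

end Literature.AnabelianGeometry.SemiGraphs

end
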